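import Literature.MathematicalPhysics.QuantumFieldTheory.Balaban1983to89.B8Prop5JoinSectELocalRDTraceFree
import Literature.MathematicalPhysics.QuantumFieldTheory.Balaban1983to89.B8Prop5GaugeParamKLevelPer
import Literature.MathematicalPhysics.QuantumFieldTheory.Balaban1983to89.B8Prop5NeumannPeriodic
import Literature.MathematicalPhysics.QuantumFieldTheory.Balaban1983to89.B8Thm2TorusLettersPerConv

/-!
# `Balaban1983to89.B8Prop5JoinSectELocalRDTraceFreePer` — [Balaban1985RegularSpaces] Prop. 5 (1.107)–(1.109) p. 94 ON THE TORUS (§3 p. 98):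
# PROPOSITION 5's GAUGE PARAMETER IN THE KNIT's CURRENCY with the trace-free clause, the identity laws of [4] READ AT PERIODIC ARGUMENTS ONLY
# (sub-row «G-B8-T2S», RULING #4 v3, layer 3(d) of `lit-balaban-t2s-1/g2/V3-DESIGN.md`)

statement-level skeleton of published theorems with citation tags; proofs where landed; nothing here is a claim about the
Yang–Mills mass gap

T. Bałaban, *Spaces of regular gauge field configurations on a lattice and gauge fixing conditions*, Commun. Math. Phys. **99** (1985) 75–102
`[Balaban1985RegularSpaces]` ("B8"): Prop. 5 (1.107)–(1.109) p. 94, (1.95)–(1.106) pp. 92–94, (1.113)–(1.114) p. 95, (1.29) p. 81, (1.17) p. 78,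
§3 p. 98.  STATUS: published, refereed.

CITATION HEADER (lean-in-tree rule).  Cell `lit-balaban`, seat `lit-balaban-t2s-1` (gen 2).  WHAT IS PROVED.  ★ `hFP_kLevel_of179_local_RD_traceFree_per`
— `B8Prop5JoinSectELocalRDTraceFree.hFP_kLevel_of179_local_RD_traceFree` VERBATIM except (RULING #4, lead 02:20Z): the right-inverse law `g_rightΩ`
((E1)) and the range law `c_range` ((E2)) of the [4] letters are assumed AT `P`-PERIODIC ARGUMENTS ONLY (the torus letters of
`B8Thm2TorusLettersPer.LettersAtPer` through the π-converter `B8Thm2TorusLettersPerConv`); the background `U₀` and the bond field `A` are periodic,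
`G′` is periodic-valued, `Q′ᵀ·C·Q′` maps periodic functions to periodic functions (`hqcq_per`); every hypothesis on the Sect. E correction `H_c` (and
Sect. E's (1.114) `h179E`) is assumed at periodic `λ` only, `H_c` periodic-valued there.  The identity laws are then used exactly twice, at `R(−Z)` and at
`Q′ᵀφ`, both periodic by `B8Prop5NeumannPeriodic.zsol_per` (the Neumann solution `Z` of (1.96) is periodic for periodic data).  ADDED conclusion: the
gauge parameter `λ′` is `P`-periodic.

HONEST SCOPE.  Verbatim re-thread; [4], (1.99), Sect. E, [3] Prop. 10 NOT proved (displayed hypotheses); count-neutral; N05 ∕ `stub_PV3A` NOT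
discharged; nothing continuum ∕ ℝ⁴ ∕ OS ∕ mass-gap ∕ Clay — the Yang–Mills mass gap is NOT proved.  No `sorry`, no `def`, no `… : Prop` fact, no
`instance`, no `notation`.
-/

noncomputable section

open NormedSpace Metric Set Filter Topology
open Complex (I)
open scoped BigOperators

namespace Literature.MathematicalPhysics.QuantumFieldTheory.Balaban1983to89.B8Prop5JoinSectELocalRDTraceFreePer

open MatrixLog (mlog)
open B7Prop1Explicit (e U1 expUnit)
open B7Prop2Explicit (unitaryUnits C0 c2')
open B7Prop1Local (InBox pdevOn)
open B7Prop3Flat (expCfg c3)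
open B7Eq78Linearization (conjR)
open B7Prop10General (C6 C4G)
open B7Prop9Flat (C5')
open B8Ineq130 (tlo thi)
open B7Eq92Concrete (mgauge)
open B8Eq119TwistedAxial (InAx Restr129)
open B8Eq178Averages (Cond179)
open B8Ineq132 (covDerivFwd covDeriv)
open B8Eq138LandauZd (covLap covDivB QT)
open B8Eq182Proof (gAd)
open B8Eq184Proof (gaugeExp)
open B8Eq188Proof (frakF3 gAd_neg)
open B8LambdaSpaceKLevel (wt lamSubK lamOf norm_le_iff)
open B8Prop5ContractionKLevel (Bd2 Mc Kc Zsol Vop Wsrc PsiP5)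
open B8Prop5GaugeParamKLevelPer (gpar_size_at gaugeParam_kLevel_traceFree_per)
open B8Prop5KLevelLetters (multiplier_iff_of_whyZ)
open B8Eq195Linear (proj325_sub)
open B8Prop5JoinSectELocal (restr129_mul_gaugeExp_local)
open B8Prop5JoinHFP (covLap_neg')
open B8Prop5NeumannPeriodic (zsol_per Wsrc_per Vop_per covDivB_per)
open B8Thm2TorusLettersPerConv (covLap_per)

-- `Site` alone could resolve to the torus sites of `Setup.lean`; re-export the `ℤ^d` sites of `B7Prop1Explicit`.
export B7Prop1Explicit (Site)

variable {d : ℕ} {𝔸 : Type*} [CStarAlgebra 𝔸] [Nontrivial 𝔸]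

variable (τ : 𝔸 →L[ℂ] ℂ)

variable {L k : ℕ} {η : ℝ} {Ω Λs : ℕ → Set (Site d)} {Eb : ℕ → Set (Site d × Fin d)} {U₀ : Site d → Fin d → 𝔸ˣ}
  {A : Site d → Fin d → 𝔸} {u₁ : Site d → 𝔸ˣ}

/-- ★ **PROPOSITION 5's GAUGE PARAMETER (JOIN-B, local route) WITH THE TRACE-FREE CLAUSE, ON THE TORUS** —
`B8Prop5JoinSectELocalRDTraceFree.hFP_kLevel_of179_local_RD_traceFree` VERBATIM with (E1) `g_rightΩ`, (E2) `c_range` at PERIODIC arguments only,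
periodic `U₀`, `A`, periodic-valued `G′`, `H_c`, periodicity-preserving `Q′ᵀCQ′`, the `H_c`-hypotheses and (1.114) at periodic `λ` only; conclusion as
there PLUS `λ′` periodic. [cite: Balaban1985RegularSpaces, Prop. 5 (1.107)–(1.109) p.94, (1.95)–(1.106) pp.92–94, (1.113)–(1.114) p.95, (1.29) p.81, (1.17) p.78, §3 p.98] -/
theorem hFP_kLevel_of179_local_RD_traceFree_per (hτ : ∀ x y : 𝔸, τ (x * y) = τ (y * x))
    (hlog : ∀ a b : 𝔸, ‖a‖ + ‖b‖ ≤ 1 / 2 → τ (mlog (exp a * exp b)) = τ a + τ b)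
    (hL : 2 ≤ L) (hη : 0 < η) (hd : 1 ≤ d) (hU₀ : ∀ x κ, U₀ x κ ∈ unitaryUnits 𝔸) (P : ℤ)
    (hEbΩ : ∀ j, j ≤ k → ∀ x ∈ Ω j, ∀ μ : Fin d, (x, μ) ∈ Eb j ∧ (x - e μ, μ) ∈ Eb j)
    (hEbT : ∀ j, j ≤ k → ∀ y ∈ Λs j, ∀ (x : Site d) (κ : Fin d), InBox (tlo L y j) (thi L y j) x →
      InBox (tlo L y j) (thi L y j) (x + e κ) → (x, κ) ∈ Eb j)
    -- letters of [4]
    (g Δ : (Site d → 𝔸) →ₗ[ℂ] (Site d → 𝔸)) (q : (Site d → 𝔸) →ₗ[ℂ] (ℕ → Site d → 𝔸)) (qs : (ℕ → Site d → 𝔸) →ₗ[ℂ] (Site d → 𝔸))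
    (Aw c : (ℕ → Site d → 𝔸) →ₗ[ℂ] (ℕ → Site d → 𝔸))
    (g_rightΩ : ∀ x, (∀ (z : Site d) (i : Fin d), x (z + P • e i) = x z) → ∀ y ∈ Ω 0, (Δ (g x) + qs (Aw (q (g x)))) y = x y)
    (c_range : ∀ f, (∀ (z : Site d) (i : Fin d), f (z + P • e i) = f z) → q (g (g (qs (c (q f))))) = q f)
    -- the torus: periodic background ∕ datum, periodicity-preserving letters
    (hU₀per : ∀ (z : Site d) (i : Fin d), U₀ (z + P • e i) = U₀ z) (hAper : ∀ (z : Site d) (i : Fin d), A (z + P • e i) = A z)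
    (hGper : ∀ (f : Site d → 𝔸) (z : Site d) (i : Fin d), g f (z + P • e i) = g f z)
    (hqcq_per : ∀ f : Site d → 𝔸, (∀ (z : Site d) (i : Fin d), f (z + P • e i) = f z) →
      ∀ (z : Site d) (i : Fin d), qs (c (q f)) (z + P • e i) = qs (c (q f)) z)
    (hΔ : ∀ (f : Site d → 𝔸), ∀ x ∈ Ω 0, Δ f x = covLap η U₀ ((Ω 0).indicator f) x)
    (hqs : ∀ (μ : ℕ → Site d → 𝔸), ∀ x ∈ Ω 0, qs μ x = QT L k Λs U₀ μ x)
    (Hc : (Site d → 𝔸) → (Site d → 𝔸))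
    -- the tower-local regime of the inversion route (datum AT u₁)
    {B : Site d → Fin d → 𝔸} {α₀ αP cB : ℝ}
    (hα : 0 < α₀) (hα3 : C0 d * α₀ ≤ 1 / 3) (hα4 : 4 * α₀ ≤ c2' d L) (hcB : 0 ≤ cB)
    (hαP : 0 < αP) (hαP3 : C0 d * αP ≤ 1 / 3) (hαP2 : 2 * αP ≤ c2' d L)
    (hBu : ∀ (x : Site d) (κ : Fin d), expCfg B x κ ∈ unitaryUnits 𝔸)
    (h33 : ∀ j, j ≤ k → ∀ y ∈ Λs j, pdevOn (tlo L y j) (thi L y j) U₀ < α₀ * (((L : ℝ) ^ j)⁻¹) ^ 2)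
    (h69 : ∀ j, j ≤ k → ∀ y ∈ Λs j, ∀ (x : Site d) (κ : Fin d), InBox (tlo L y j) (thi L y j) x →
      InBox (tlo L y j) (thi L y j) (x + e κ) → ‖B x κ‖ ≤ cB * ((L : ℝ) ^ j)⁻¹)
    (hP : ∀ j, j ≤ k → ∀ y ∈ Λs j, pdevOn (tlo L y j) (thi L y j) (expCfg B * U₀) < αP * (((L : ℝ) ^ j)⁻¹) ^ 2)
    (hAx : InAx L k Λs U₀ (mgauge U₀ u₁ (expCfg B) * U₀)) (h129 : Restr129 L k Λs U₀ u₁)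
    (hsmall : Real.exp (4 * (800 * ((d : ℝ) + 1) ^ 2 * ((d : ℝ) + 4)) * α₀) * (1 + 8 * (131072 * ((d : ℝ) + 1) ^ 2) * cB) ≤ 2)
    (hc₃ : 2 * cB ≤ c3 d L) (hsc : 2048 * (d : ℝ) * cB ≤ 1) (hα₃' : 40 * d * cB ≤ 1 / 200)
    {α₄ BG BR h₀ h₁ h₂ l₀ l₁ l₂ cA cDA : ℝ}
    (hw₁ : 10 * C6 d * (4 * (2 * α₄)) ≤ 1) (hw₂ : 3000 * ((d : ℝ) + 1) * L * (4 * (2 * α₄)) ≤ 1)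
    (hw₃ : C4G d L * (α₀ + 40 * d * cB + 4 * (2 * α₄)) ≤ 1)
    (hw₄ : 1024 * ((d : ℝ) + 1) * ((d : ℝ) + 4) * L ^ 2 * α₀ ≤ 1) (hw₅ : 32 * ((d : ℝ) + 1) ^ 2 * C6 d * L ^ 2 * α₀ ≤ 1)
    (hw₆ : 16 * d * C5' d * C6 d * (L : ℝ) ^ 2 * α₀ ≤ 1) (hprod : 2 * C6 d * (40 * d * cB + 4 * (2 * α₄)) < 1 / 2)
    -- JOIN-B's windows, letters G′/R, H_c's eight binders, the datum
    (hα₄ : 0 < α₄) (hBG : 0 ≤ BG) (hBR : 0 ≤ BR) (hh₀ : 0 ≤ h₀) (hh₂ : 0 ≤ h₂) (hl₀ : 0 ≤ l₀) (hl₁ : 0 ≤ l₁)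
    (hl₂ : 0 ≤ l₂) (hcA : 0 ≤ cA) (hcA' : cA ≤ 1 / 13) (hcDA : 0 ≤ cDA)
    (ha₁' : α₄ / 4 + h₀ ≤ 1 / 24) (hb₁' : α₄ / 4 + h₁ ≤ 1 / 140) (hb₁ : 0 < α₄ / 4 + h₁) (hθ : 10 * (α₄ / 4 + h₀) * BR ≤ 1 / 2)
    (hh₀' : h₀ ≤ 3 * α₄ / 4) (hh₁' : h₁ ≤ 3 * α₄ / 4)
    (hG : ∀ (f : Site d → 𝔸) (m : ℝ), 0 ≤ m → Bd2 L η k Ω f m →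
      (∀ x, ‖g f x‖ ≤ BG * m) ∧ ∀ j, j ≤ k → ∀ p ∈ Eb j, wt L η j * ‖covDerivFwd η U₀ p.2 (g f) p.1‖ ≤ BG * m)
    (hGsupp : ∀ (f : Site d → 𝔸) (x : Site d), x ∉ Ω 0 → g f x = 0)
    (hGreal : ∀ f : Site d → 𝔸, (∀ j, j ≤ k → ∀ x ∈ Ω j, IsSelfAdjoint (f x)) → ∀ x, IsSelfAdjoint (g f x))
    (hRbd : ∀ (f : Site d → 𝔸) (m : ℝ), 0 ≤ m → Bd2 L η k Ω f m → Bd2 L η k Ω (f - g (qs (c (q (g f))))) (BR * m))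
    (hRreal : ∀ f : Site d → 𝔸, (∀ j, j ≤ k → ∀ x ∈ Ω j, IsSelfAdjoint (f x)) →
      ∀ j, j ≤ k → ∀ x ∈ Ω j, IsSelfAdjoint ((f - g (qs (c (q (g f))))) x))
    (hc0 : ∀ s : lamSubK η U₀ L k Eb, (∀ (z : Site d) (i : Fin d), lamOf s (z + P • e i) = lamOf s z) → ‖s‖ ≤ α₄ / 4 →
      ∀ x, ‖Hc (lamOf s) x‖ ≤ h₀)
    (hc1 : ∀ s : lamSubK η U₀ L k Eb, (∀ (z : Site d) (i : Fin d), lamOf s (z + P • e i) = lamOf s z) → ‖s‖ ≤ α₄ / 4 →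
      ∀ j, j ≤ k → ∀ p ∈ Eb j, wt L η j * ‖covDerivFwd η U₀ p.2 (Hc (lamOf s)) p.1‖ ≤ h₁)
    (hc2 : ∀ s : lamSubK η U₀ L k Eb, (∀ (z : Site d) (i : Fin d), lamOf s (z + P • e i) = lamOf s z) → ‖s‖ ≤ α₄ / 4 →
      Bd2 L η k Ω (covLap η U₀ (Hc (lamOf s))) h₂)
    (hcL0 : ∀ s t : lamSubK η U₀ L k Eb, (∀ (z : Site d) (i : Fin d), lamOf s (z + P • e i) = lamOf s z) → (∀ (z : Site d) (i : Fin d), lamOf t (z + P • e i) = lamOf t z) →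
      ‖s‖ ≤ α₄ / 4 → ‖t‖ ≤ α₄ / 4 → ∀ x, ‖Hc (lamOf s) x - Hc (lamOf t) x‖ ≤ l₀ * ‖s - t‖)
    (hcL1 : ∀ s t : lamSubK η U₀ L k Eb, (∀ (z : Site d) (i : Fin d), lamOf s (z + P • e i) = lamOf s z) → (∀ (z : Site d) (i : Fin d), lamOf t (z + P • e i) = lamOf t z) →
      ‖s‖ ≤ α₄ / 4 → ‖t‖ ≤ α₄ / 4 → ∀ j, j ≤ k → ∀ p ∈ Eb j,
      wt L η j * ‖covDerivFwd η U₀ p.2 (Hc (lamOf s) - Hc (lamOf t)) p.1‖ ≤ l₁ * ‖s - t‖)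
    (hcL2 : ∀ s t : lamSubK η U₀ L k Eb, (∀ (z : Site d) (i : Fin d), lamOf s (z + P • e i) = lamOf s z) → (∀ (z : Site d) (i : Fin d), lamOf t (z + P • e i) = lamOf t z) →
      ‖s‖ ≤ α₄ / 4 → ‖t‖ ≤ α₄ / 4 → Bd2 L η k Ω (covLap η U₀ (Hc (lamOf s)) - covLap η U₀ (Hc (lamOf t))) (l₂ * ‖s - t‖))
    (hcsa : ∀ s : lamSubK η U₀ L k Eb, (∀ (z : Site d) (i : Fin d), lamOf s (z + P • e i) = lamOf s z) → ‖s‖ ≤ α₄ / 4 →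
      (∀ x, IsSelfAdjoint (lamOf s x)) → ∀ x, IsSelfAdjoint (Hc (lamOf s) x))
    (hcsupp : ∀ s : lamSubK η U₀ L k Eb, (∀ (z : Site d) (i : Fin d), lamOf s (z + P • e i) = lamOf s z) → ‖s‖ ≤ α₄ / 4 →
      ∀ x, x ∉ Ω 0 → Hc (lamOf s) x = 0)
    (hcper : ∀ s : lamSubK η U₀ L k Eb, (∀ (z : Site d) (i : Fin d), lamOf s (z + P • e i) = lamOf s z) → ‖s‖ ≤ α₄ / 4 →
      ∀ (z : Site d) (i : Fin d), Hc (lamOf s) (z + P • e i) = Hc (lamOf s) z)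
    (hDA : Bd2 L η k Ω (fun y => covDivB η U₀ A y) cDA) (hDAsa : ∀ j, j ≤ k → ∀ x ∈ Ω j, IsSelfAdjoint (covDivB η U₀ A x))
    (hA : ∀ j, j ≤ k → ∀ x ∈ Ω j, ∀ μ : Fin d,
      wt L η j * ‖A x μ‖ ≤ cA ∧ wt L η j * ‖conjR (U₀ (x - e μ) μ)⁻¹ (A (x - e μ) μ)‖ ≤ cA)
    (hAsa : ∀ x μ, IsSelfAdjoint (A x μ))
    (h103 : BG * Mc d BR (α₄ / 4 + h₁) cA h₂ cDA ≤ α₄ / 4)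
    (h106 : BG * Kc d BR (α₄ / 4 + h₁) cA h₂ cDA l₂ (1 + l₀) (1 + l₁) ≤ 1 / 2)
    -- Sect. E's (1.114) in its printed use, for the inverse pair, at the abstract H_c
    (h179E : ∀ s : lamSubK η U₀ L k Eb, (∀ (z : Site d) (i : Fin d), lamOf s (z + P • e i) = lamOf s z) → ‖s‖ ≤ α₄ / 4 → q (lamOf s) = 0 →
      Cond179 L k Λs U₀ (fun x => expUnit (((-I) • (lamOf s + Hc (lamOf s))) x)) u₁⁻¹)
    -- `τ`-freeness of the datum, the correction and the letters (joint J-SU)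
    (hDAτ : ∀ j, j ≤ k → ∀ x ∈ Ω j, τ (covDivB η U₀ A x) = 0)
    (hcτ : ∀ s : lamSubK η U₀ L k Eb, (∀ (z : Site d) (i : Fin d), lamOf s (z + P • e i) = lamOf s z) → ‖s‖ ≤ α₄ / 4 →
      (∀ x, τ (lamOf s x) = 0) → ∀ x, τ (Hc (lamOf s) x) = 0)
    (hRτ : ∀ f : Site d → 𝔸, (∀ j, j ≤ k → ∀ x ∈ Ω j, τ (f x) = 0) →
      ∀ j, j ≤ k → ∀ x ∈ Ω j, τ ((f - g (qs (c (q (g f))))) x) = 0)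
    (hGτ : ∀ f : Site d → 𝔸, (∀ j, j ≤ k → ∀ x ∈ Ω j, τ (f x) = 0) → ∀ x, τ (g f x) = 0) :
    ∃ lam : Site d → 𝔸, (∀ (z : Site d) (i : Fin d), lam (z + P • e i) = lam z) ∧
      (∀ x, IsSelfAdjoint (lam x)) ∧ (∀ x, x ∉ Ω 0 → lam x = 0) ∧ (∀ x, τ (lam x) = 0) ∧
      (∀ j, j ≤ k → ∀ p ∈ Eb j, ‖lam p.1‖ ≤ α₄ ∧ wt L η j * ‖covDerivFwd η U₀ p.2 lam p.1‖ ≤ α₄) ∧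
      (∃ μ : ℕ → Site d → 𝔸, ∀ x ∈ Ω 0,
        covLap η U₀ ((Ω 0).indicator fun y => covDivB η U₀ A y + covLap η U₀ lam y +
          ((conjR (gaugeExp lam y)⁻¹ (covDivB η U₀ A y) - covDivB η U₀ A y) +
            (gAd (covLap η U₀ lam y) (lam y) - covLap η U₀ lam y) + ∑ μ, frakF3 η U₀ lam A y μ)) x = QT L k Λs U₀ μ x) ∧
      Restr129 L k Λs U₀ (u₁ * gaugeExp lam) := by
  have hL1 : 1 ≤ L := le_trans (by norm_num) hL
  -- the letter R of (1.95)
  set R : (Site d → 𝔸) → (Site d → 𝔸) := fun f => f - g (qs (c (q (g f)))) with hRdef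
  have hR : ∀ f, R f = f - g (qs (c (q (g f)))) := fun f => rfl
  have hRsub : ∀ f f' : Site d → 𝔸, R (f - f') = R f - R f' := proj325_sub (R := R) hR
  have hR0 : R 0 = 0 := by rw [hR]; simp
  have hRneg : ∀ f : Site d → 𝔸, R (-f) = -R f := fun f => by rw [← zero_sub, hRsub, hR0, zero_sub]
  have hRper : ∀ f : Site d → 𝔸, (∀ (z : Site d) (i : Fin d), f (z + P • e i) = f z) →
      ∀ (z : Site d) (i : Fin d), R f (z + P • e i) = R f z := fun f hf z i => by
    simp only [hR, Pi.sub_apply, hf z i, hGper]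
  -- JOIN-A
  obtain ⟨s, s', hp, hp', hs, hfix, hs', hn', hsa', hoff', hN, hτ'⟩ := gaugeParam_kLevel_traceFree_per (Ω := Ω) (Eb := Eb) (U₀ := U₀) (A := A)
    (DA := fun y => covDivB η U₀ A y) τ hτ hlog hL1 hη hU₀ P hEbΩ (⇑g) R Hc hα₄.le hBG hBR hh₀ hh₂ hl₀ hl₁ hl₂ hcA hcA' hcDA ha₁' hb₁' hb₁ hθ
    hh₀' hh₁' hG (fun f f' => map_sub g f f') hGper hGsupp hGreal hRsub hRbd hRreal hc0 hc1 hc2 hcL0 hcL1 hcL2 hcsa hcsupp hcper hDA hDAsa hA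
    hAsa h103 h106 hDAτ hcτ hRτ hGτ
  set lam' := lamOf s' with hlam'def
  have hgp : lamOf s + Hc (lamOf s) = lam' := hs'.symm
  -- the Neumann solution at λ′
  set Z : Site d → 𝔸 := Zsol (Wsrc η U₀ A (fun y => covDivB η U₀ A y) lam' (covLap η U₀ (Hc (lamOf s)))) (Vop lam') R with hZdef
  -- on the torus: Z, −Z, R(−Z), g Z are periodic
  have hZper : ∀ (z : Site d) (i : Fin d), Z (z + P • e i) = Z z :=
    zsol_per (Wsrc_per hU₀per hAper (covDivB_per hU₀per hAper) hp' (covLap_per hU₀per (hcper s hp hs))) (fun f hf => Vop_per hp' hf) hRper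
  have hZneg : ∀ (z : Site d) (i : Fin d), (-Z) (z + P • e i) = (-Z) z := fun z i => by simp only [Pi.neg_apply, hZper z i]
  -- the fixed point read through the projection laws: Q′λ = 0 and Δλ = R(−Z)
  have hfix' : lamOf s = g (R (fun x => -Z x)) := by
    have h := hfix
    simp only [PsiP5] at h
    rw [hgp] at h
    exact h
  have hfix'' : lamOf s = g (R (-Z)) := hfix'
  have hqR : q (g (R (-Z))) = 0 := by
    rw [hR, map_sub, map_sub, c_range _ (fun z i => hGper _ z i), sub_self]
  have hq : q (lamOf s) = 0 := by rw [hfix'']; exact hqR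
  -- «ΔG′R = R» read POINTWISE on Ω₀ (the right-inverse law of G′ on print's domain)
  have hΔs : ∀ y ∈ Ω 0, Δ (lamOf s) y = R (-Z) y := fun y hy => by
    have h1 := g_rightΩ (R (-Z)) (hRper _ hZneg) y hy
    rw [hqR, map_zero, map_zero, add_zero] at h1
    rw [hfix'']
    exact h1
  -- sizes at λ′ on Ω₀
  have hl : ∀ y ∈ Ω 0, ‖lam' y‖ ≤ 1 / 12 := fun y _ => by
    rw [← hgp]; exact (gpar_size_at s hs (hc0 s hp hs) y).trans (ha₁'.trans (by norm_num))
  -- support of λ_s (Dirichlet range of G′)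
  have hoff : ∀ x, x ∉ Ω 0 → lamOf s x = 0 := fun x hx => by rw [hfix'']; exact hGsupp _ x hx
  have hind : (Ω 0).indicator (lamOf s) = lamOf s := by
    funext x
    by_cases hx : x ∈ Ω 0
    · rw [Set.indicator_of_mem hx]
    · rw [Set.indicator_of_notMem hx, hoff x hx]
  refine ⟨lam', hp', hsa', hoff', hτ', fun j hj p hpj => ?_, ?_, ?_⟩
  · -- (1.108)
    have h := (norm_le_iff hη.le s' hα₄.le).1 hn'
    exact ⟨h.1 p.1, h.2 j hj p hpj⟩
  · -- the multiplier clause, via n04-b's WHY-Z bridge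
    have hdef : lam' = lamOf s - (-Hc (lamOf s)) := by rw [sub_neg_eq_add, hgp]
    have hNy : ∀ y ∈ Ω 0, Z y + (gAd (R Z y) (lam' y) - R Z y) =
        conjR (gaugeExp lam' y)⁻¹ (covDivB η U₀ A y) - gAd (covLap η U₀ (-Hc (lamOf s)) y) (lam' y) + ∑ μ, frakF3 η U₀ lam' A y μ := by
      intro y hy
      have h := hN 0 (Nat.zero_le _) y hy
      simp only [Vop, Wsrc] at h
      rw [h, covLap_neg', gAd_neg _ (hl y hy), sub_neg_eq_add]
    have hΔy : ∀ y ∈ Ω 0, covLap η U₀ (lamOf s) y = -R Z y := by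
      intro y hy
      rw [← hind, ← hΔ _ y hy, hΔs y hy, hRneg, Pi.neg_apply]
    refine (multiplier_iff_of_whyZ L k (Ω 0) Λs U₀ A hdef hl hNy hΔy).2 ?_
    set φ := c (q (g Z)) with hφ
    refine ⟨φ - Aw (q (g (qs φ))), fun x hx => ?_⟩
    have hZR : Z - R Z = g (qs φ) := by rw [hR]; abel
    -- «ΔG′Q′ᵀφ = Q′ᵀ(φ − 𝔄Q′G′Q′ᵀφ)» read POINTWISE on Ω₀
    have hlap : Δ (g (qs φ)) x = qs (φ - Aw (q (g (qs φ)))) x := by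
      rw [map_sub, Pi.sub_apply]
      exact eq_sub_of_add_eq (by rw [← Pi.add_apply]; exact g_rightΩ (qs φ) (hqcq_per _ fun z i => hGper _ z i) x hx)
    rw [← hΔ _ x hx, hZR, hlap, hqs _ x hx]
  · -- (1.29) for u₁·e^{iλ′} by the LOCAL inversion route
    rw [← hgp]
    -- the local route at THIS `s` (its `H_c`-inputs are read at `s` only: feed the constant map `λ ↦ H_cλ_s`)
    exact restr129_mul_gaugeExp_local hL hη hd hU₀ hEbT hα hα3 hα4 hcB hα₄ hαP hαP3 hαP2 hBu h33 h69 hP hAx h129 hsmall hc₃ hsc hα₃' hw₁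
      hw₂ hw₃ hw₄ hw₅ hw₆ hprod (fun _ => Hc (lamOf s)) hh₀' hh₁' (fun _ _ x => hc0 s hp hs x) (fun _ _ j hj p hpj => hc1 s hp hs j hj p hpj) s hs
      (h179E s hp hs hq)


#print axioms hFP_kLevel_of179_local_RD_traceFree_per

end Literature.MathematicalPhysics.QuantumFieldTheory.Balaban1983to89.B8Prop5JoinSectELocalRDTraceFreePer

end
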